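import Literature.Geometry.Manifold.FreeCircleQuotientProjection
import Literature.Geometry.Kaehler.ManifoldFormsPullback
import HarnessLib

/-!
# Basic forms descend along the orbit map of a free circle action

Fourth proofs companion of `OrigamiUnfolding.lean` (fact seat of
`Literature.Geometry.Symplectic.exists_symplecticCutPieces_of_isOrigamiForm`), the form-level half
of step (S2) of the unfolding (Cannas da Silva–Guillemin–Pires, *Symplectic Origami*, proof of
Prop. 2.8: "Let `ω_B` be the reduced symplectic form on `ℬ`. Then `i*ω = π*ω_B` …" — the base
`B = Z/S¹` carries the form of which `i*ω` is the pull-back; likewise the reduced forms on the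
symplectic cuts `(Z × ℂ)/S¹`). For a free smooth circle action on a Hausdorff manifold `N`
(modelled on `ℝᵐ`) with orbit manifold `N/S¹ = CircleQuotient N`
(`Literature/Geometry/Manifold/FreeCircleQuotient*.lean`) and a `k`-form `α` on `N`
(`Literature.Geometry.Kaehler.MForm`):

* `circleFundVec n` — the fundamental vector `d/dt|₀ exp t • n`; `IsCircleBasicForm α` —
  `α` is invariant (`(a • ·)^* α = α`) and horizontal (`ι_X α = 0`);
* `IsCircleBasicForm.apply_eq_of_forall_exists_smul` / `…_of_mfderiv_eq` / `…_of_mfderiv_eq'`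
  — a basic form evaluated on `k` vectors depends only on their images under `dπ`, at a point
  and along an orbit (`ker dπ_n = ℝ · X_n`, `exists_smul_of_mfderiv_circleQuotientMk_eq_zero`);
* `circleDescend α` — the descended form on `N/S¹` (evaluate at a representative on lifts,
  `exists_rightInverse_mfderiv_circleQuotientMk`), with **`π^* (circleDescend α) = α`**
  (`IsCircleBasicForm.pullback_circleDescend`) and uniqueness
  (`MForm.pullback_circleQuotientMk_injective`: `π^*` is injective on forms);
* **`IsCircleBasicForm.isSmoothForm_circleDescend`** — the descent of a smooth basic form is
  smooth (near an orbit it is the pull-back of `α` along the smooth local section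
  `param ∘ chart` of a slice chart, `MForm.SmoothAt.pullback`);
* **`IsCircleBasicForm.isClosedForm_circleDescend`** — and closed if `α` is
  (`mextDeriv_pullback_apply`: `π^* d = d π^*`, and `dπ` is onto);
* `IsCircleBasicForm.circleDescend_nondegenerate` — a basic `2`-form whose kernel is exactly
  the vertical line descends to a non-degenerate form ("`ω_B` is symplectic").

Everything here is proved; the definitions (`circleFundVec`, `circleDescend`, the structure
`IsCircleBasicForm`) are concrete; no facts.

## References

* A. Cannas da Silva, V. Guillemin, A. R. Pires, *Symplectic Origami*, IMRN 2011 =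
  arXiv:0909.4065, Def. 2.2, proof of Prop. 2.8. [CannasdasilvaGuilleminPires2010]
* J. M. Lee, *Introduction to Smooth Manifolds*, 2nd ed. (2012), Thm. 21.10.
  [LeeSmoothManifolds2013]
-/

noncomputable section

open scoped Manifold ContDiff Topology
open Set Function Module Filter
open Literature.Geometry.Kaehler Literature.Geometry.Manifold

namespace Literature.Geometry.Symplectic

section Basic

variable {m : ℕ} {N : Type*} [TopologicalSpace N] [ChartedSpace (EuclideanSpace ℝ (Fin m)) N]
  [MulAction Circle N] {k : ℕ}

/-- The **fundamental vector** of the circle action at `n`: the velocity at `t = 0` of the orbit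
`t ↦ exp t • n`, as a tangent vector at `n`. [folklore] -/
def circleFundVec (n : N) : TangentSpace (𝓡 m) n :=
  mfderiv 𝓘(ℝ, ℝ) (𝓡 m) (fun t : ℝ => Circle.exp t • n) 0 (1 : ℝ)

/-- `circleFundVec n` is the orbit velocity. [folklore] -/
theorem circleFundVec_eq (n : N) :
    circleFundVec n = mfderiv 𝓘(ℝ, ℝ) (𝓡 m) (fun t : ℝ => Circle.exp t • n) 0 (1 : ℝ) := rfl

/-- A `k`-form on a manifold with a circle action is **basic** when it is invariant under the
action and horizontal (it vanishes as soon as one argument is the fundamental vector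
`d/dt|₀ exp t • n` of the action). For the null fibration of an origami form, `i*ω` is basic
(Cannas da Silva–Guillemin–Pires, Def. 2.2 and the proof of Prop. 2.8: "`i*ω = π*ω_B`").
[cite: CannasdasilvaGuilleminPires2010, Def. 2.2] -/
structure IsCircleBasicForm (α : MForm (𝓡 m) N ℝ k) : Prop where
  /-- Invariance: `(a • ·)^* α = α`. -/
  invariant : ∀ (a : Circle) (n : N) (v : Fin k → TangentSpace (𝓡 m) n),
    α (a • n) (fun i => mfderiv (𝓡 m) (𝓡 m) (fun x : N => a • x) n (v i)) = α n v
  /-- Horizontality: `ι_X α = 0` for the fundamental vector field `X`. -/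
  horizontal : ∀ (n : N) (v : Fin k → TangentSpace (𝓡 m) n) (i : Fin k),
    v i = circleFundVec n → α n v = 0

/-- A horizontal form is unchanged when multiples of the fundamental vector are added to its
arguments (multilinearity, one slot at a time). [folklore] -/
theorem IsCircleBasicForm.apply_eq_of_forall_exists_smul {α : MForm (𝓡 m) N ℝ k}
    (hα : IsCircleBasicForm α) (n : N) {v v' : Fin k → TangentSpace (𝓡 m) n}
    (h : ∀ i, ∃ c : ℝ, v' i = v i + c • circleFundVec n) :
    α n v' = α n v := by
  set X : TangentSpace (𝓡 m) n := circleFundVec n with hX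
  -- replace the slots one at a time
  let g : ℕ → Fin k → TangentSpace (𝓡 m) n := fun j i => if (i : ℕ) < j then v' i else v i
  have hg0 : g 0 = v := by
    funext i
    simp [g]
  have hgk : g k = v' := by
    funext i
    simp [g, i.2]
  have hstep : ∀ j : ℕ, α n (g (j + 1)) = α n (g j) := by
    intro j
    by_cases hj : j < k
    · set jj : Fin k := ⟨j, hj⟩ with hjj
      obtain ⟨c, hc⟩ := h jj
      have hupd : g (j + 1) = Function.update (g j) jj (g j jj + c • X) := by
        funext i
        by_cases hij : i = jj
        · subst hij
          simp only [Function.update_self, g]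
          have h1 : ((⟨j, hj⟩ : Fin k) : ℕ) < j + 1 := Nat.lt_succ_self j
          have h2 : ¬ ((⟨j, hj⟩ : Fin k) : ℕ) < j := lt_irrefl j
          rw [if_pos h1, if_neg h2]
          exact hc
        · rw [Function.update_of_ne hij]
          have hne : (i : ℕ) ≠ j := fun h' => hij (Fin.ext h')
          simp only [g]
          by_cases hlt : (i : ℕ) < j
          · rw [if_pos hlt, if_pos (Nat.lt_succ_of_lt hlt)]
          · have : ¬ (i : ℕ) < j + 1 := by omega
            rw [if_neg hlt, if_neg this]
      rw [hupd, (α n).map_update_add, (α n).map_update_smul, Function.update_eq_self,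
        hα.horizontal n _ jj (Function.update_self _ _ _), smul_zero, add_zero]
    · have : g (j + 1) = g j := by
        funext i
        have hi : (i : ℕ) < j := lt_of_lt_of_le i.2 (not_lt.1 hj)
        simp only [g, if_pos hi, if_pos (Nat.lt_succ_of_lt hi)]
      rw [this]
  have hall : ∀ j : ℕ, α n (g j) = α n v := by
    intro j
    induction j with
    | zero => rw [hg0]
    | succ j ih => rw [hstep, ih]
  rw [← hgk]
  exact hall k

end Basic

section Descent

variable {m : ℕ} {N : Type*} [TopologicalSpace N] [ChartedSpace (EuclideanSpace ℝ (Fin m)) N]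
  [IsManifold (𝓡 m) ∞ N] [T2Space N] [MulAction Circle N]
  {F : Type*} [NormedAddCommGroup F] [NormedSpace ℝ F] [FiniteDimensional ℝ F] {k : ℕ}
  (hθ : ContMDiff ((𝓡 1).prod (𝓡 m)) (𝓡 m) ∞ (fun x : Circle × N => x.1 • x.2))
  (hfree : ∀ (a : Circle) (x : N), a • x = x → a = 1)
  (hF : Module.finrank ℝ F + 1 = m)

include hθ hfree hF

/-- **The kernel of `dπ_n` consists of the multiples of the fundamental vector** (it is a line,
`finrank_ker_mfderiv_circleQuotientMk`, containing the non-zero fundamental vector).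
[cite: LeeSmoothManifolds2013, Thm. 21.10] -/
theorem exists_smul_of_mfderiv_circleQuotientMk_eq_zero (n : N) (v : TangentSpace (𝓡 m) n)
    (hv : letI := circleQuotientChartedSpace F hθ hfree hF
      mfderiv (𝓡 m) 𝓘(ℝ, F) (circleQuotientMk : N → CircleQuotient N) n v = 0) :
    ∃ c : ℝ, v = c • circleFundVec n := by
  letI := circleQuotientChartedSpace F hθ hfree hF
  haveI : FiniteDimensional ℝ (TangentSpace (𝓡 m) n) :=
    inferInstanceAs (FiniteDimensional ℝ (EuclideanSpace ℝ (Fin m)))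
  set L := (mfderiv (𝓡 m) 𝓘(ℝ, F) (circleQuotientMk : N → CircleQuotient N) n).toLinearMap
    with hL
  set X : TangentSpace (𝓡 m) n := circleFundVec n with hX
  have hXK : X ∈ LinearMap.ker L := by
    rw [LinearMap.mem_ker]
    exact mfderiv_circleQuotientMk_apply_orbit hθ hfree hF n
  have hX0 : X ≠ 0 :=
    mfderiv_circleOrbit_apply_one_ne_zero (θ := fun (a : Circle) (x : N) => a • x) hθ
      (one_smul Circle) (fun a b x => mul_smul a b x) hfree n
  have h1 : Module.finrank ℝ (LinearMap.ker L) = 1 :=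
    finrank_ker_mfderiv_circleQuotientMk hθ hfree hF n
  have hvK : v ∈ LinearMap.ker L := by rw [LinearMap.mem_ker]; exact hv
  obtain ⟨c, hc⟩ := (finrank_eq_one_iff_of_nonzero' (⟨X, hXK⟩ : LinearMap.ker L)
    (fun h => hX0 (congrArg Subtype.val h))).1 h1 ⟨v, hvK⟩
  exact ⟨c, (congrArg Subtype.val hc).symm⟩

/-- **A basic form depends only on the images of its arguments under `dπ`**, at a point.
[cite: CannasdasilvaGuilleminPires2010, Def. 2.2] -/
theorem IsCircleBasicForm.apply_eq_of_mfderiv_eq {α : MForm (𝓡 m) N ℝ k}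
    (hα : IsCircleBasicForm α) (n : N) {v v' : Fin k → TangentSpace (𝓡 m) n}
    (h : letI := circleQuotientChartedSpace F hθ hfree hF
      ∀ i, mfderiv (𝓡 m) 𝓘(ℝ, F) (circleQuotientMk : N → CircleQuotient N) n (v' i) =
        mfderiv (𝓡 m) 𝓘(ℝ, F) (circleQuotientMk : N → CircleQuotient N) n (v i)) :
    α n v' = α n v := by
  letI := circleQuotientChartedSpace F hθ hfree hF
  refine hα.apply_eq_of_forall_exists_smul n fun i => ?_
  obtain ⟨c, hc⟩ := exists_smul_of_mfderiv_circleQuotientMk_eq_zero hθ hfree hF n (v' i - v i)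
    (by rw [map_sub, h i, sub_self])
  exact ⟨c, by rw [← hc, add_sub_cancel]⟩

/-- **A basic form depends only on the images of its arguments under `dπ`, along an orbit**:
if `n' = a • n` and `dπ (v' i) = dπ (v i)` then `α n' v' = α n v` (invariance, and the previous
lemma at `n'` with the lifts `d(a • ·) v i`). [cite: CannasdasilvaGuilleminPires2010, Def. 2.2] -/
theorem IsCircleBasicForm.apply_eq_of_mfderiv_eq' {α : MForm (𝓡 m) N ℝ k}
    (hα : IsCircleBasicForm α) (n n' : N) (hn' : ∃ a : Circle, a • n = n')
    {v : Fin k → TangentSpace (𝓡 m) n} {v' : Fin k → TangentSpace (𝓡 m) n'}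
    (h : letI := circleQuotientChartedSpace F hθ hfree hF
      ∀ i, mfderiv (𝓡 m) 𝓘(ℝ, F) (circleQuotientMk : N → CircleQuotient N) n' (v' i) =
        mfderiv (𝓡 m) 𝓘(ℝ, F) (circleQuotientMk : N → CircleQuotient N) n (v i)) :
    α n' v' = α n v := by
  letI := circleQuotientChartedSpace F hθ hfree hF
  obtain ⟨a, rfl⟩ := hn'
  -- the lifts `w i = d(a • ·)_n (v i)` at `a • n` have `dπ (w i) = dπ (v i)`
  have hsm : ContMDiff (𝓡 m) (𝓡 m) ∞ (fun x : N => a • x) :=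
    hθ.comp (contMDiff_const.prodMk contMDiff_id)
  have hπ : MDifferentiableAt (𝓡 m) 𝓘(ℝ, F) (circleQuotientMk : N → CircleQuotient N) (a • n) :=
    ((contMDiff_circleQuotientMk hθ hfree hF) _).mdifferentiableAt (by simp)
  have ha : MDifferentiableAt (𝓡 m) (𝓡 m) (fun x : N => a • x) n :=
    hsm.contMDiffAt.mdifferentiableAt (by simp)
  have hcomp := (hπ.hasMFDerivAt.comp n ha.hasMFDerivAt).mfderiv
  have hfun : ((circleQuotientMk : N → CircleQuotient N) ∘ fun x : N => a • x) =
      circleQuotientMk := funext fun x => circleQuotientMk_smul a x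
  rw [hfun] at hcomp
  have hw : ∀ i, mfderiv (𝓡 m) 𝓘(ℝ, F) (circleQuotientMk : N → CircleQuotient N) (a • n)
      (mfderiv (𝓡 m) (𝓡 m) (fun x : N => a • x) n (v i)) =
      mfderiv (𝓡 m) 𝓘(ℝ, F) (circleQuotientMk : N → CircleQuotient N) n (v i) := by
    intro i
    have := congrArg (fun L => L (v i)) hcomp
    exact this.symm
  rw [← hα.invariant a n v]
  exact hα.apply_eq_of_mfderiv_eq hθ hfree hF (a • n) fun i => (h i).trans (hw i).symm

/-- A right inverse of `dπ` at the chosen representative `q.out` of an orbit `q` (it exists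
because `dπ` is surjective onto a finite-dimensional space). [folklore] -/
theorem exists_rightInverse_mfderiv_circleQuotientMk (n : N) :
    letI := circleQuotientChartedSpace F hθ hfree hF
    ∃ L : F →L[ℝ] TangentSpace (𝓡 m) n, ∀ u,
      mfderiv (𝓡 m) 𝓘(ℝ, F) (circleQuotientMk : N → CircleQuotient N) n (L u) = u := by
  letI := circleQuotientChartedSpace F hθ hfree hF
  set D := (mfderiv (𝓡 m) 𝓘(ℝ, F) (circleQuotientMk : N → CircleQuotient N) n).toLinearMap
    with hD
  obtain ⟨g, hg⟩ := D.exists_rightInverse_of_surjective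
    (LinearMap.range_eq_top.2 (surjective_mfderiv_circleQuotientMk hθ hfree hF n))
  refine ⟨LinearMap.toContinuousLinearMap g, fun u => ?_⟩
  exact congrArg (fun f : F →ₗ[ℝ] F => f u) hg

/-- **The descent of a form along `π : N → N/S¹`**: at an orbit `q`, evaluate `α` at the chosen
representative `q.out` on chosen lifts of the arguments. For a basic form this is independent
of the choices (`IsCircleBasicForm.pullback_descend`). [cite: CannasdasilvaGuilleminPires2010, Def. 2.2] -/
def circleDescend (α : MForm (𝓡 m) N ℝ k) :
    letI := circleQuotientChartedSpace F hθ hfree hF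
    MForm 𝓘(ℝ, F) (CircleQuotient N) ℝ k :=
  letI := circleQuotientChartedSpace F hθ hfree hF
  fun q => (α q.out).compContinuousLinearMap
    (Classical.choose (exists_rightInverse_mfderiv_circleQuotientMk hθ hfree hF q.out))

/-- The descended form evaluated on `dπ`-images: `(descend α) (π n) (dπ v) = α n v` for a basic
form — i.e. **`π^* (descend α) = α`**. [cite: CannasdasilvaGuilleminPires2010, Def. 2.2] -/
theorem IsCircleBasicForm.circleDescend_apply {α : MForm (𝓡 m) N ℝ k} (hα : IsCircleBasicForm α)
    (n : N) (v : Fin k → TangentSpace (𝓡 m) n) :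
    letI := circleQuotientChartedSpace F hθ hfree hF
    circleDescend hθ hfree hF α (circleQuotientMk n)
      (fun i => mfderiv (𝓡 m) 𝓘(ℝ, F) (circleQuotientMk : N → CircleQuotient N) n (v i)) =
      α n v := by
  letI := circleQuotientChartedSpace F hθ hfree hF
  set q : CircleQuotient N := circleQuotientMk n with hq
  have hL := Classical.choose_spec (exists_rightInverse_mfderiv_circleQuotientMk hθ hfree hF q.out)
  set L := Classical.choose (exists_rightInverse_mfderiv_circleQuotientMk hθ hfree hF q.out)
  show (α q.out) (fun i => L (mfderiv (𝓡 m) 𝓘(ℝ, F)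
    (circleQuotientMk : N → CircleQuotient N) n (v i))) = α n v
  have hout : ∃ a : Circle, a • n = q.out :=
    circleQuotientMk_eq_iff.1 (Quotient.out_eq q)
  exact hα.apply_eq_of_mfderiv_eq' hθ hfree hF n q.out hout fun i => hL _

/-- **`π^* (descend α) = α`** for a basic form. [cite: CannasdasilvaGuilleminPires2010, Def. 2.2] -/
theorem IsCircleBasicForm.pullback_circleDescend {α : MForm (𝓡 m) N ℝ k}
    (hα : IsCircleBasicForm α) :
    letI := circleQuotientChartedSpace F hθ hfree hF
    (circleDescend hθ hfree hF α).pullback (𝓡 m) (circleQuotientMk : N → CircleQuotient N) = α := by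
  letI := circleQuotientChartedSpace F hθ hfree hF
  funext n
  ext v
  rw [MForm.pullback_apply]
  exact hα.circleDescend_apply hθ hfree hF n v

/-- **Forms on the orbit space are determined by their pull-backs** (`dπ` and `π` are
surjective). [folklore] -/
theorem MForm.pullback_circleQuotientMk_injective :
    letI := circleQuotientChartedSpace F hθ hfree hF
    Injective fun β : MForm 𝓘(ℝ, F) (CircleQuotient N) ℝ k =>
      β.pullback (𝓡 m) (circleQuotientMk : N → CircleQuotient N) := by
  letI := circleQuotientChartedSpace F hθ hfree hF
  intro β β' h
  funext q
  obtain ⟨n, rfl⟩ := circleQuotientMk_surjective q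
  ext u
  choose v hv using fun i => surjective_mfderiv_circleQuotientMk hθ hfree hF n (u i)
  have h' := congrArg (fun γ : MForm (𝓡 m) N ℝ k => γ n v) h
  simp only [MForm.pullback_apply] at h'
  have hu : (fun i => mfderiv (𝓡 m) 𝓘(ℝ, F) (circleQuotientMk : N → CircleQuotient N) n (v i)) =
      u := funext hv
  rw [hu] at h'
  exact h'

/-- **The descent of a smooth basic form is smooth**: near an orbit `q₀` it is the pull-back
of `α` along the smooth local section `σ = param ∘ chart` of the slice chart at `q₀.out`
(`π ∘ σ = id`, so `dπ ∘ dσ = id` and both `σ^*α` and `descend α` evaluate `α` on lifts).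
[cite: CannasdasilvaGuilleminPires2010, Def. 2.2] -/
theorem IsCircleBasicForm.isSmoothForm_circleDescend {α : MForm (𝓡 m) N ℝ k}
    (hα : IsCircleBasicForm α) (hsm : IsSmoothForm α) :
    letI := circleQuotientChartedSpace F hθ hfree hF
    IsSmoothForm (circleDescend hθ hfree hF α) := by
  letI := circleQuotientChartedSpace F hθ hfree hF
  haveI : ContinuousSMul Circle N := ⟨hθ.continuous⟩
  haveI := isManifold_circleQuotient (F := F) hθ hfree hF
  rw [isSmoothForm_iff_smoothAt]
  intro q₀
  set p : N := q₀.out with hp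
  set d : CircleSliceData (EuclideanSpace ℝ (Fin m)) F p := circleSliceDataAt hθ hfree hF p
    with hd
  have hchart : chartAt F q₀ = d.chart := rfl
  set σ : CircleQuotient N → N := fun z => d.param (d.chart z) with hσ
  have hsrc : d.chart.source ∈ 𝓝 q₀ := by
    rw [← hchart]
    exact (chartAt F q₀).open_source.mem_nhds (mem_chart_source F q₀)
  -- `σ` is smooth on the chart source and `π ∘ σ = id` there
  have hσs : ContMDiffOn 𝓘(ℝ, F) (𝓡 m) ∞ σ d.chart.source := by
    refine d.contMDiffOn_param.comp ?_ fun z hz => d.chart.map_source hz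
    rw [← hchart]
    exact contMDiffOn_chart
  have hπσ : ∀ z ∈ d.chart.source, circleQuotientMk (σ z) = z := by
    intro z hz
    have h := d.chart.left_inv hz
    rwa [d.chart_symm_apply] at h
  -- pointwise: `descend α = σ^* α` on the chart source
  have heq : ∀ᶠ z in 𝓝 q₀, (α.pullback 𝓘(ℝ, F) σ) z = circleDescend hθ hfree hF α z := by
    filter_upwards [hsrc] with z hz
    have hσz : ContMDiffAt 𝓘(ℝ, F) (𝓡 m) ∞ σ z :=
      hσs.contMDiffAt (d.chart.open_source.mem_nhds hz)
    have hσd : MDifferentiableAt 𝓘(ℝ, F) (𝓡 m) σ z := hσz.mdifferentiableAt (by simp)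
    have hπd : MDifferentiableAt (𝓡 m) 𝓘(ℝ, F) (circleQuotientMk : N → CircleQuotient N) (σ z) :=
      ((contMDiff_circleQuotientMk hθ hfree hF) _).mdifferentiableAt (by simp)
    -- `dπ ∘ dσ = id` at `z`
    have hid : ∀ u : TangentSpace 𝓘(ℝ, F) z,
        mfderiv (𝓡 m) 𝓘(ℝ, F) (circleQuotientMk : N → CircleQuotient N) (σ z)
          (mfderiv 𝓘(ℝ, F) (𝓡 m) σ z u) = u := by
      intro u
      have hc := (hπd.hasMFDerivAt.comp z hσd.hasMFDerivAt).mfderiv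
      have hloc : ((circleQuotientMk : N → CircleQuotient N) ∘ σ) =ᶠ[𝓝 z] id := by
        filter_upwards [d.chart.open_source.mem_nhds hz] with w hw
        exact hπσ w hw
      rw [hloc.mfderiv_eq, mfderiv_id] at hc
      have := congrArg (fun L => L u) hc
      exact this.symm
    ext u
    rw [MForm.pullback_apply]
    -- both sides evaluate `α` on lifts of `u` at points of the orbit `z`
    have hz' : circleQuotientMk (σ z) = z := hπσ z hz
    have key := hα.circleDescend_apply hθ hfree hF (σ z)
      (fun i => mfderiv 𝓘(ℝ, F) (𝓡 m) σ z (u i))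
    simp only [hid] at key
    rw [hz'] at key
    exact key.symm
  -- smoothness of `σ^* α` at `q₀`
  have hpull : (α.pullback 𝓘(ℝ, F) σ).SmoothAt q₀ := by
    refine MForm.SmoothAt.pullback ?_ ((isSmoothForm_iff_smoothAt α).1 hsm _)
    filter_upwards [hsrc] with z hz
    exact hσs.contMDiffAt (d.chart.open_source.mem_nhds hz)
  exact hpull.congr_of_eventuallyEq heq

/-- **The descent of a closed smooth basic form is closed**: `π^* d(descend α) = d(π^* descend α)
= dα = 0` and `dπ` is surjective. [cite: CannasdasilvaGuilleminPires2010, Def. 2.2] -/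
theorem IsCircleBasicForm.isClosedForm_circleDescend {α : MForm (𝓡 m) N ℝ k}
    (hα : IsCircleBasicForm α) (hsm : IsSmoothForm α) (hcl : IsClosedForm α) :
    letI := circleQuotientChartedSpace F hθ hfree hF
    IsClosedForm (circleDescend hθ hfree hF α) := by
  letI := circleQuotientChartedSpace F hθ hfree hF
  haveI := isManifold_circleQuotient (F := F) hθ hfree hF
  have hsmQ := hα.isSmoothForm_circleDescend hθ hfree hF hsm
  show mextDeriv (circleDescend hθ hfree hF α) = 0
  funext q
  obtain ⟨n, rfl⟩ := circleQuotientMk_surjective q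
  have hπ : ∀ᶠ z in 𝓝 n, ContMDiffAt (𝓡 m) 𝓘(ℝ, F) ∞
      (circleQuotientMk : N → CircleQuotient N) z :=
    Filter.Eventually.of_forall fun z => (contMDiff_circleQuotientMk hθ hfree hF) z
  have hnat := mextDeriv_pullback_apply (I := 𝓡 m) (I' := 𝓘(ℝ, F)) hπ
    ((isSmoothForm_iff_smoothAt _).1 hsmQ _)
  rw [hα.pullback_circleDescend hθ hfree hF] at hnat
  have h0 : mextDeriv α n = 0 := congrFun hcl n
  rw [h0] at hnat
  -- `(d descend α).pullback π n = 0` and `dπ_n` is surjective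
  ext u
  choose v hv using fun i => surjective_mfderiv_circleQuotientMk hθ hfree hF n (u i)
  have h' := congrArg (fun γ : TangentSpace (𝓡 m) n [⋀^Fin (k + 1)]→L[ℝ] ℝ => γ v) hnat
  simp only [MForm.pullback_apply, ContinuousAlternatingMap.coe_zero, Pi.zero_apply] at h'
  have hu : (fun i => mfderiv (𝓡 m) 𝓘(ℝ, F) (circleQuotientMk : N → CircleQuotient N) n (v i)) =
      u := funext hv
  rw [hu] at h'
  rw [← h']
  rfl

/-- **Non-degeneracy descends**: if the kernel of a basic `2`-form is exactly the vertical line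
(`α(v, ·) = 0 ⇒ dπ v = 0`), the descended `2`-form is non-degenerate — for the null fibration of
an origami form this is "`ω_B` is symplectic" (`ker i*ω = V`, Def. 2.1–2.2).
[cite: CannasdasilvaGuilleminPires2010, Def. 2.2] -/
theorem IsCircleBasicForm.circleDescend_nondegenerate {α : MForm (𝓡 m) N ℝ 2}
    (hα : IsCircleBasicForm α)
    (hker : letI := circleQuotientChartedSpace F hθ hfree hF
      ∀ (n : N) (v : TangentSpace (𝓡 m) n), (∀ w, α n ![v, w] = 0) →
        mfderiv (𝓡 m) 𝓘(ℝ, F) (circleQuotientMk : N → CircleQuotient N) n v = 0) :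
    letI := circleQuotientChartedSpace F hθ hfree hF
    ∀ (q : CircleQuotient N) (u : TangentSpace 𝓘(ℝ, F) q), u ≠ 0 →
      ∃ u' : TangentSpace 𝓘(ℝ, F) q, circleDescend hθ hfree hF α q ![u, u'] ≠ 0 := by
  letI := circleQuotientChartedSpace F hθ hfree hF
  intro q u hu
  obtain ⟨n, rfl⟩ := circleQuotientMk_surjective q
  obtain ⟨v, rfl⟩ := surjective_mfderiv_circleQuotientMk hθ hfree hF n u
  by_contra hcon
  push Not at hcon
  apply hu
  apply hker n v
  intro w
  have h := hcon (mfderiv (𝓡 m) 𝓘(ℝ, F) (circleQuotientMk : N → CircleQuotient N) n w)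
  have hvec : (![mfderiv (𝓡 m) 𝓘(ℝ, F) (circleQuotientMk : N → CircleQuotient N) n v,
      mfderiv (𝓡 m) 𝓘(ℝ, F) (circleQuotientMk : N → CircleQuotient N) n w] :
        Fin 2 → TangentSpace 𝓘(ℝ, F) (circleQuotientMk n : CircleQuotient N)) =
      fun i => mfderiv (𝓡 m) 𝓘(ℝ, F) (circleQuotientMk : N → CircleQuotient N) n (![v, w] i) := by
    funext i
    fin_cases i <;> rfl
  rw [hvec, hα.circleDescend_apply hθ hfree hF n ![v, w]] at h
  exact h

end Descent

end Literature.Geometry.Symplectic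

end
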